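import Summits.QuantumFields.YangMills.Theses.ScalingWindowSplit
import Literature.MathematicalPhysics.QuantumLattice.LatticeGaugeDLR
import Literature.MathematicalPhysics.QuantumFieldTheory.WilsonTransferKernel

/-!
# Ideator-1 sketch — crux stmt-QuantumFields-18927 `ScalingWindowSplit.GapAtCorrelationLength` (W₁), round 1

Typed objects for the crux idea `plaquette-scale-mixing-certificate` (transfer lens):

* `W1At G` — the body of W₁ at one group `G` (verbatim copy; `gapAtCorrelationLength_iff` certifies it by `Iff.rfl`).
* `TVCond ρ β b n ε` — the Dobrushin–Shlosman TV finite-size condition of `OneCertifiedCube.FiniteSizeCriterion`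
  (verbatim inner block), for the Wilson specification in representation `ρ` at coupling `β`, cell size `b`.
* `PlaquetteScaleCertificateAt G` — the transfer target C⁺ at one group: a weak-coupling Wilson scheme with
  polynomial volumes along which (i) the TV certificate holds at cell sizes `b_k ≤ ℓ / a_k` (at most `ℓ` PHYSICAL
  units) and (ii) the bare plaquette floor/window of W₁ hold at the SAME spacing `a_k` — the certifying scale is
  pinned to the plaquette correlation length (ONE scale), so the certificate rate `κ/b_k ≥ (κ/ℓ)·a_k` is W₁'s `Δ·a_k`.
* `CertificateToColdPressure` — stub B of the line: a certificate at cell size `b` gives COLD PRESSURE (trace excess of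
  the transfer semigroup `≤ C₀ b⁴ (2S+1)³ e^{−κ(m+2)/b}`) on every odd torus `2S+1 ≥ (8n+7)b`; the landed
  `rpSpectral_of_coldPressure_scheme` + `stub_gapOfRPSpectral` then give W₁'s clauses (bridge `w1At_of_certificate`).

For `π₁(G) ≠ 0` both `TVCond` at every scale and cold pressure are physics-false ('t Hooft light flux: `LightFlux G`,
Part A of `LightFluxObstruction.lean`, forces a non-decorrelating global slab functional, which complete analyticity
would decorrelate after `n ≫ b log S`), exactly like W₁ as typed; there the line must use the good-exterior weak-mixing
currency of `Cruxes/NonSimplyConnectedLatticeGap` (`GoodExteriorMixingNSC`) and the sector-refined local clause — see the card.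
-/

noncomputable section

open scoped BigOperators Topology
open MeasureTheory Filter Set Function
open Literature.MathematicalPhysics.QuantumLattice Literature.MathematicalPhysics.AQFT
open Literature.MathematicalPhysics.QuantumFieldTheory

namespace Summit.QuantumFields.YangMills.Cruxes.GapAtCorrelationLength.Ideator1

open Summit.QuantumFields.YangMills.Theses.ScalingWindowSplit (GapAtCorrelationLength)

/-- The body of W₁ at one compact group `G` (verbatim). [folklore] -/
def W1At (G : Type) [Group G] [TopologicalSpace G] [IsTopologicalGroup G] [CompactSpace G] : Prop :=
  let E := EuclideanSpace ℝ (Fin 4); letI : MeasurableSpace G := borel G; haveI : BorelSpace G := ⟨rfl⟩; ∃ (r : LatticeRep G) (sch : SpeciesScheme (YMSpecies G)) (u : SchwartzMap E ℝ) (p : ℕ) (M Δ C : ℝ), let bare : SpeciesScheme (YMSpecies G) := { sch with c := fun _ _ => 1, m := fun _ _ => 0 }; let T : SchwartzMap E ℝ → ℕ → ℝ := fun w k => latticeSchwinger r.ρ bare (fun s => s.F) k (1 + 1) (fun _ => r.curvature) ![w, thetaTest 4 w] - latticeSchwinger r.ρ bare (fun s => s.F) k 1 (fun _ => r.curvature)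 ![w] * latticeSchwinger r.ρ bare (fun s => s.F) k 1 (fun _ => r.curvature) ![thetaTest 4 w]; sch.HasWeakCouplingLimit ∧ (∃ N : ℕ, 1 ≤ N ∧ ∀ᶠ k in Filter.atTop, (sch.a k)⁻¹ ≤ (sch.a k * (sch.L k : ℝ)) ^ N) ∧ 0 < Δ ∧ HasLatticeMassGap r sch Δ ∧ (∀ᶠ k in Filter.atTop, ∀ (S₀ T₀ n : ℕ), sch.L k ≤ S₀ → 2 * (T₀ + n + 1) ≤ S₀ → ∀ (Y : LGConfig 4 G → ℝ) (B : ℝ), Measurable Y → (∀ U, |Y U| ≤ B) → DependsOn Y {e : Literature.MathematicalPhysics.QuantumLattice.ZdEdge 4 | 1 ≤ e.1 0 ∧ e.1 0 + (if e.2 = 0 then 1 else 0) ≤ T₀} → |(∫ U, Y (torusLift (2 * S₀ + 1) (GaugeConfig.timeReflect U)) * Y (configShift (-Pi.single 0 (n : ℤ)) (torusLift (2 * S₀ + 1) U)) ∂(wilsonMeasure r.ρ (sch.β k) : Measure (GaugeConfig 4 (2 * S₀ + 1) G))) - (∫ U, Y (torusLift (2 * S₀ + 1) U) ∂(wilsonMeasure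 r.ρ (sch.β k) : Measure (GaugeConfig 4 (2 * S₀ + 1) G))) ^ 2| ≤ Real.exp (-(Δ * sch.a k * n)) * ((∫ U, Y (torusLift (2 * S₀ + 1) (GaugeConfig.timeReflect U)) * Y (torusLift (2 * S₀ + 1) U) ∂(wilsonMeasure r.ρ (sch.β k) : Measure (GaugeConfig 4 (2 * S₀ + 1) G))) - (∫ U, Y (torusLift (2 * S₀ + 1) U) ∂(wilsonMeasure r.ρ (sch.β k) : Measure (GaugeConfig 4 (2 * S₀ + 1) G))) ^ 2) + C * B ^ 2 * Real.exp (-(Δ * sch.a k * S₀))) ∧ tsupport u ⊆ {y : E | y 0 < 0} ∧ ∀ᶠ k in Filter.atTop, (sch.a k) ^ p ≤ T u k ∧ T u k ≤ M * T (timeShiftTest 4 (-1) u) k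

/-- `W₁ ↔ ∀ G, IsCompactSimpleLieGroup G → W1At G` (definitional). [folklore] -/
theorem gapAtCorrelationLength_iff :
    GapAtCorrelationLength ↔
      ∀ (G : Type) [Group G] [TopologicalSpace G] [IsTopologicalGroup G] [CompactSpace G],
        IsCompactSimpleLieGroup G → W1At G :=
  Iff.rfl

/-- The Dobrushin–Shlosman TV finite-size condition (inner block of `OneCertifiedCube.FiniteSizeCriterion`, verbatim):
representation `ρ`, coupling `β`, cell size `b`, shell count `n`, tolerance `ε`. [cite: DobrushinShlosman1985] -/
def TVCond {G : Type} [Group G] [TopologicalSpace G] [IsTopologicalGroup G] [CompactSpace G] [MeasurableSpace G]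
    [BorelSpace G] {N : ℕ} (ρ : G →* Matrix (Fin N) (Fin N) ℂ) (β : ℝ) (b n : ℕ) (ε : ℝ) : Prop :=
  ∀ w : Fin 4 → ℤ → ℤ, (∀ i j, w i j + ((b : ℕ) : ℤ) ≤ w i (j + 1) ∧ w i (j + 1) ≤ w i j + 2 * ((b : ℕ) : ℤ)) → ∀ Y : Finset (Fin 4 → ℤ), Y ⊆ (Fintype.piFinset fun _ : Fin 4 => Finset.Icc (-(2 * ((n : ℕ) : ℤ))) (2 * ((n : ℕ) : ℤ))) → (0 : Fin 4 → ℤ) ∈ Y → ∀ η η' : Literature.MathematicalPhysics.QuantumLattice.LGConfig 4 G, (∀ e ∈ (Fintype.piFinset fun _ : Fin 4 => Finset.Icc (-(2 * ((n : ℕ) : ℤ))) (2 * ((n : ℕ) : ℤ))).biUnion (fun y : Fin 4 → ℤ => (Fintype.piFinset fun i : Fin 4 => Finset.Ico (w i (y i)) (w i (y i + 1))) ×ˢ (Finset.univ : Finset (Fin 4))), η e = η' e) → ∀ f : Literature.MathematicalPhysics.QuantumLattice.LGConfig 4 G → ℝ, Literature.MathematicalPhysics.QuantumLattice.IsCylinder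 f ((fun y : Fin 4 → ℤ => (Fintype.piFinset fun i : Fin 4 => Finset.Ico (w i (y i)) (w i (y i + 1))) ×ˢ (Finset.univ : Finset (Fin 4))) 0) → Measurable f → (∀ U, 0 ≤ f U ∧ f U ≤ 1) → |(∫ U, f U ∂(Literature.MathematicalPhysics.QuantumLattice.ymSpecification ρ β (Y.biUnion (fun y : Fin 4 → ℤ => (Fintype.piFinset fun i : Fin 4 => Finset.Ico (w i (y i)) (w i (y i + 1))) ×ˢ (Finset.univ : Finset (Fin 4)))) η)) - ∫ U, f U ∂(Literature.MathematicalPhysics.QuantumLattice.ymSpecification ρ β (Y.biUnion (fun y : Fin 4 → ℤ => (Fintype.piFinset fun i : Fin 4 => Finset.Ico (w i (y i)) (w i (y i + 1))) ×ˢ (Finset.univ : Finset (Fin 4)))) η')| ≤ ε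

/-- **C⁺ at one group: a plaquette-scale certificate.**  A weak-coupling scheme with polynomial volumes, admissible
`(n, ε)`, a physical length `ℓ`, cell sizes `b_k` with `(8n+7) b_k ≤ 2L_k+1`, `b_k a_k ≤ ℓ` and the TV certificate at
`(β_k, b_k)` eventually, together with W₁'s bare plaquette floor and window for one past-supported bump `u` at the SAME
spacing `a_k` (one scale). [folklore] -/
def PlaquetteScaleCertificateAt (G : Type) [Group G] [TopologicalSpace G] [IsTopologicalGroup G] [CompactSpace G] : Prop :=
  let E := EuclideanSpace ℝ (Fin 4)
  letI : MeasurableSpace G := borel G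
  haveI : BorelSpace G := ⟨rfl⟩
  ∃ (r : LatticeRep G) (sch : SpeciesScheme (YMSpecies G)) (b : ℕ → ℕ) (n : ℕ) (ε ℓ : ℝ)
    (u : SchwartzMap E ℝ) (p : ℕ) (M : ℝ),
    let bare : SpeciesScheme (YMSpecies G) := { sch with c := fun _ _ => 1, m := fun _ _ => 0 }; let T : SchwartzMap E ℝ → ℕ → ℝ := fun w k => latticeSchwinger r.ρ bare (fun s => s.F) k (1 + 1) (fun _ => r.curvature) ![w, thetaTest 4 w] - latticeSchwinger r.ρ bare (fun s => s.F) k 1 (fun _ => r.curvature) ![w] * latticeSchwinger r.ρ bare (fun s => s.F) k 1 (fun _ => r.curvature) ![thetaTest 4 w]; 1 ≤ n ∧ 0 ≤ ε ∧ ε * ((((4 * n + 3) ^ 4 - (4 * n + 1) ^ 4 : ℕ)) : ℝ) < 1 ∧ 0 < ℓ ∧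
    sch.HasWeakCouplingLimit ∧
    (∃ N : ℕ, 1 ≤ N ∧ ∀ᶠ k in Filter.atTop, (sch.a k)⁻¹ ≤ (sch.a k * (sch.L k : ℝ)) ^ N) ∧
    (∀ᶠ k in Filter.atTop, 1 ≤ b k ∧ (8 * n + 7) * b k ≤ 2 * sch.L k + 1 ∧ (b k : ℝ) * sch.a k ≤ ℓ ∧
      TVCond r.ρ (sch.β k) (b k) n ε) ∧
    tsupport u ⊆ {y : E | y 0 < 0} ∧
    ∀ᶠ k in Filter.atTop, (sch.a k) ^ p ≤ T u k ∧ T u k ≤ M * T (timeShiftTest 4 (-1) u) k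

/-- **Stub B of the line (open, L): certificate ⇒ cold pressure.**  For admissible `(n, ε)` there are `κ > 0` and `C₀`
such that for every compact `G` with continuous faithful `ρ`, every `β ≥ 0` and cell size `b ≥ 1` at which the TV
certificate holds, the trace excess of the cold odd torus `(m+2) × (2S+1)³`, `2S+1 ≥ (8n+7)b`, `S+1 ≤ 2(m+2)`, is at most
`C₀ b⁴ (2S+1)³ e^{−κ (m+2)/b}` (complete analyticity at scale `b` ⇒ uniform spectral gap `κ/b` of the transfer operator AND a
massive-gas density of states; Dobrushin–Shlosman conditions IIIc/IIId). [cite: DobrushinShlosman1987] -/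
def CertificateToColdPressure : Prop :=
  ∀ (n : ℕ) (ε : ℝ), 1 ≤ n → 0 ≤ ε → ε * ((((4 * n + 3) ^ 4 - (4 * n + 1) ^ 4 : ℕ)) : ℝ) < 1 →
    ∃ κ : ℝ, 0 < κ ∧ ∃ C₀ : ℝ, 0 ≤ C₀ ∧
      ∀ (G : Type) [Group G] [TopologicalSpace G] [IsTopologicalGroup G] [CompactSpace G] [MeasurableSpace G]
        [BorelSpace G] (N : ℕ) (ρ : G →* Matrix (Fin N) (Fin N) ℂ), Continuous ρ → Function.Injective ρ →
        ∀ (β : ℝ), 0 ≤ β → ∀ (b : ℕ), 1 ≤ b → TVCond ρ β b n ε →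
          ∀ (S : ℕ), (8 * n + 7) * b ≤ 2 * S + 1 → ∀ (m : ℕ), S + 1 ≤ 2 * (m + 2) →
            traceExcess ρ β (2 * S + 1) (m + 2) ≤
              C₀ * (b : ℝ) ^ 4 * ((2 * S + 1 : ℕ) : ℝ) ^ 3 * Real.exp (-(κ * ((m + 2 : ℕ) : ℝ) / b))

/-- **First lemma of the line (bridge; M given the landed cold-pressure chain):** a plaquette-scale certificate at `G`
gives the body of W₁ at `G`, with `Δ := κ/(4ℓ)` and `C := 16 K`.  Intended proof: stub B at `(β_k, b_k)` ⇒ cold pressure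
at rate `κ/b_k ≥ (κ/ℓ) a_k` on all tori `S ≥ L_k`; the volume floor `C₀ b_k⁴ (2S+1)³ e^{−(κ/ℓ) a_k S/2} ≤ K` holds
eventually by PolyVolume; `rpSpectral_of_coldPressure_scheme` gives the RP-spectral clause at rate `(κ/4ℓ) a_k`,
`stub_gapOfRPSpectral`/`gapPair_of_rpSpectral` give `HasLatticeMassGap`; the remaining clauses are hypotheses. [folklore] -/
theorem w1At_of_certificate (hB : CertificateToColdPressure)
    (G : Type) [Group G] [TopologicalSpace G] [IsTopologicalGroup G] [CompactSpace G]
    (hG : IsCompactSimpleLieGroup G) (hC : PlaquetteScaleCertificateAt G) : W1At G := by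
  sorry

end Summit.QuantumFields.YangMills.Cruxes.GapAtCorrelationLength.Ideator1

end
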